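import Mathlib.RingTheory.Ideal.KrullsHeightTheorem
import Mathlib.RingTheory.Ideal.MinimalPrime.Localization
import Mathlib.RingTheory.KrullDimension.Basic
import Summits.ResolutionOfSingularities.ResolutionOfSingularities.Theorems.FrobeniusLadderFInjectiveMacaulayficationFrobeniusClosedMove
import Summits.ResolutionOfSingularities.ResolutionOfSingularities.Theorems.FrobeniusLadderFInjectiveMacaulayficationParameterCentreNoGo
import HarnessLib

/-!
# One Frobenius closed parameter ideal makes all of them Frobenius closed (Cohen–Macaulay local rings)

Support file for crux stmt-ResolutionOfSingularities-15315 (`FrobeniusLadder.FInjectiveMacaulayfication`,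
line `Sketch`). Let `(R, 𝔪)` be a Noetherian local ring of prime characteristic `p` which is
Cohen–Macaulay in the sense of the route (every system of parameters is a weakly regular sequence, in
the given order). **If ONE ideal generated by a system of parameters is Frobenius closed, then EVERY
ideal generated by a system of parameters is Frobenius closed**
(`isFrobeniusClosed_of_isFrobeniusClosed_sop`; Fedder 1983 / Quy–Shimomoto 2017 §3 for Cohen–Macaulay
rings, here WITHOUT local cohomology): two systems of parameters are joined by a chain whose consecutive
members differ in one element (prime avoidance against the minimal primes of the two `d`-element
sub-ideals — a prime strictly above such a minimal prime is `𝔪`, by Krull's principal ideal theorem in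
the quotient), and Frobenius-closedness moves along one-element exchanges (`Move.isFrobeniusClosed_move`).
Consequences (`§4`): the crux's per-stalk clause at a Noetherian local domain follows from "every system
of parameters weakly regular AND ONE of them Frobenius closed" (`fInjectiveClause_of_one_sop`); and at a
Cohen–Macaulay local domain that is not F-injective NO parameter ideal is Frobenius closed, so NO blow-up
of a parameter ideal serves as the crux's model (`parameterCentre_noGo_of_not_fInjective`).

References: [Fedder1983] Trans. AMS 278 (1983); [QuyShimomoto2017] Adv. Math. 313 (2017) §3;
[FedderWatanabe1989] proof of Prop. 2.2 (the exchange step).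
-/

-- single-problem summit: the doubled namespace component `ResolutionOfSingularities` is forced
set_option linter.dupNamespace false

namespace Summit.ResolutionOfSingularities.ResolutionOfSingularities.Theorems.FInjectiveMacaulayfication.OneSop

open IsLocalRing RingTheory.Sequence Literature.RingTheory.TightClosure

variable {R : Type*} [CommRing R]

/-! ## §1 Prime avoidance: a common completion of two `d`-element sub-ideals to parameter ideals -/

section Avoid

variable [IsNoetherianRing R] [IsLocalRing R]

/-- In a Noetherian local ring of dimension `d + 1`, no minimal prime of an ideal generated by at most
`d` elements is the maximal ideal (Krull's height theorem: such a prime has height `≤ d < d + 1 = ht 𝔪`).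
[folklore] -/
theorem ne_maximalIdeal_of_mem_minimalPrimes {d : ℕ}
    (hd : ringKrullDim R = ((d + 1 : ℕ) : WithBot ℕ∞)) (D : Finset R) (hD : D.card ≤ d)
    {P : Ideal R} (hP : P ∈ (Ideal.span (↑D : Set R)).minimalPrimes) : P ≠ maximalIdeal R := by
  intro hPm
  have h1 : P.height ≤ D.card := Ideal.height_le_card_of_mem_minimalPrimes_span_finset hP
  have h2 : (maximalIdeal R).height = ((d + 1 : ℕ) : ℕ∞) := by
    have h := IsLocalRing.maximalIdeal_height_eq_ringKrullDim (R := R)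
    rw [hd] at h
    exact_mod_cast h
  rw [hPm, h2] at h1
  have : d + 1 ≤ D.card := by exact_mod_cast h1
  omega

/-- If `rad (x, D) = 𝔪` and `w ∈ 𝔪` lies in no minimal prime of `(D)`, then `rad (w, D) = 𝔪`: a prime
`Q ⊇ (w, D)` contains a minimal prime `P` of `(D)` strictly (`w ∈ Q ∖ P`), and in `R/(D)` — a local ring
whose maximal ideal is minimal over the principal ideal `(x̄)`, hence of dimension `≤ 1` by Krull's
principal ideal theorem — every prime is minimal or maximal, so `Q = 𝔪`. [folklore] -/
theorem radical_span_insert_eq_of_forall_notMem (D : Finset R) {x : R}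
    (hx : (Ideal.span (insert x (↑D : Set R))).radical = maximalIdeal R) {w : R}
    (hw : w ∈ maximalIdeal R) (havoid : ∀ P ∈ (Ideal.span (↑D : Set R)).minimalPrimes, w ∉ P) :
    (Ideal.span (insert w (↑D : Set R))).radical = maximalIdeal R := by
  set K : Ideal R := Ideal.span (↑D : Set R) with hK
  have hKx : Ideal.span (insert x (↑D : Set R)) = K ⊔ Ideal.span {x} := by
    rw [Ideal.span_insert, sup_comm]
  have hKw : Ideal.span (insert w (↑D : Set R)) = K ⊔ Ideal.span {w} := by
    rw [Ideal.span_insert, sup_comm]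
  have hKm : K ≤ maximalIdeal R := by
    rw [← hx, hKx]
    exact le_sup_left.trans Ideal.le_radical
  -- `𝔪` is the only prime over `K + (x)`, in particular a minimal one
  have hmin : maximalIdeal R ∈ (K ⊔ Ideal.span {x}).minimalPrimes := by
    rw [← hKx, ← Ideal.radical_minimalPrimes, hx, Ideal.minimalPrimes_eq_subsingleton_self]
    exact Set.mem_singleton _
  -- `dim R/K ≤ 1`
  have hKtop : K ≠ ⊤ := fun h => (maximalIdeal.isMaximal R).ne_top (top_le_iff.mp (h ▸ hKm))
  haveI : Nontrivial (R ⧸ K) := Ideal.Quotient.nontrivial_iff.mpr hKtop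
  haveI : IsLocalRing (R ⧸ K) :=
    IsLocalRing.of_surjective' (Ideal.Quotient.mk K) Ideal.Quotient.mk_surjective
  have hdim : ringKrullDim (R ⧸ K) ≤ 1 := by
    rw [← IsLocalRing.maximalIdeal_height_eq_ringKrullDim,
      ← IsLocalRing.map_maximalIdeal_of_surjective (Ideal.Quotient.mk K) Ideal.Quotient.mk_surjective]
    exact_mod_cast Ideal.map_height_le_one_of_mem_minimalPrimes hmin
  haveI : Ring.KrullDimLE 1 (R ⧸ K) := ⟨by exact_mod_cast hdim⟩
  -- the radical computation
  apply le_antisymm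
  · refine (maximalIdeal.isMaximal R).isPrime.radical_le_iff.mpr ?_
    rw [hKw]
    exact sup_le hKm ((Ideal.span_singleton_le_iff_mem _).mpr hw)
  · rw [Ideal.radical_eq_sInf]
    refine le_sInf ?_
    rintro Q ⟨hJQ, hQ⟩
    have hKQ : K ≤ Q := le_sup_left.trans (hKw ▸ hJQ)
    have hwQ : w ∈ Q := hJQ (Ideal.subset_span (Set.mem_insert _ _))
    have hker : RingHom.ker (Ideal.Quotient.mk K) ≤ Q := by rw [Ideal.mk_ker]; exact hKQ
    have hQ' : (Q.map (Ideal.Quotient.mk K)).IsPrime :=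
      Ideal.map_isPrime_of_surjective Ideal.Quotient.mk_surjective hker
    have hcomap : (Q.map (Ideal.Quotient.mk K)).comap (Ideal.Quotient.mk K) = Q := by
      rw [Ideal.comap_map_of_surjective _ Ideal.Quotient.mk_surjective,
        ← RingHom.ker_eq_comap_bot, sup_eq_left.mpr hker]
    rcases (Ring.krullDimLE_one_iff.mp inferInstance) _ hQ' with hQmin | hQmax
    · -- `Q` would be a minimal prime of `K` containing `w`
      exfalso
      refine havoid Q ?_ hwQ
      rw [Ideal.minimalPrimes_eq_comap]
      exact ⟨_, hQmin, hcomap⟩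
    · have hQmax' : Q.IsMaximal := by
        rw [← hcomap]
        exact Ideal.comap_isMaximal_of_surjective _ Ideal.Quotient.mk_surjective
      rw [IsLocalRing.eq_maximalIdeal hQmax']

/-- **A common parameter.** In a Noetherian local ring of dimension `d + 1`, if `(x₁, D₁)` and
`(x₂, D₂)` are parameter ideals (`rad = 𝔪`) with `|D₁|, |D₂| ≤ d`, then some `w ∈ 𝔪` makes BOTH
`(w, D₁)` and `(w, D₂)` parameter ideals: choose `w` outside the finitely many minimal primes of `(D₁)`
and of `(D₂)`, none of which is `𝔪` (prime avoidance). [folklore] -/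
theorem exists_mem_maximalIdeal_radical_eq_and {d : ℕ}
    (hd : ringKrullDim R = ((d + 1 : ℕ) : WithBot ℕ∞)) (D₁ D₂ : Finset R)
    (hD₁ : D₁.card ≤ d) (hD₂ : D₂.card ≤ d) {x₁ x₂ : R}
    (h₁ : (Ideal.span (insert x₁ (↑D₁ : Set R))).radical = maximalIdeal R)
    (h₂ : (Ideal.span (insert x₂ (↑D₂ : Set R))).radical = maximalIdeal R) :
    ∃ w ∈ maximalIdeal R, (Ideal.span (insert w (↑D₁ : Set R))).radical = maximalIdeal R ∧
      (Ideal.span (insert w (↑D₂ : Set R))).radical = maximalIdeal R := by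
  classical
  set S : Set (Ideal R) := (Ideal.span (↑D₁ : Set R)).minimalPrimes ∪
    (Ideal.span (↑D₂ : Set R)).minimalPrimes with hS
  have hSfin : S.Finite :=
    ((Ideal.span (↑D₁ : Set R)).finite_minimalPrimes_of_isNoetherianRing).union
      ((Ideal.span (↑D₂ : Set R)).finite_minimalPrimes_of_isNoetherianRing)
  have hSprime : ∀ P ∈ S, P.IsPrime := by
    rintro P (hP | hP) <;> exact hP.1.1
  have hSne : ∀ P ∈ S, P ≠ maximalIdeal R := by
    rintro P (hP | hP)
    · exact ne_maximalIdeal_of_mem_minimalPrimes hd D₁ hD₁ hP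
    · exact ne_maximalIdeal_of_mem_minimalPrimes hd D₂ hD₂ hP
  -- prime avoidance: `𝔪 ⊄ ⋃ S`
  have havoid : ¬ ((maximalIdeal R : Set R) ⊆ ⋃ P ∈ S, (P : Set R)) := by
    rw [Ideal.subset_union_prime_finite hSfin (maximalIdeal R) (maximalIdeal R)
      (fun P hP _ _ => hSprime P hP)]
    rintro ⟨P, hPS, hle⟩
    exact hSne P hPS ((maximalIdeal.isMaximal R).eq_of_le (hSprime P hPS).ne_top hle).symm
  obtain ⟨w, hwm, hw⟩ := Set.not_subset.mp havoid
  have hw' : ∀ P ∈ S, w ∉ P := fun P hP hwP => hw (Set.mem_biUnion hP hwP)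
  exact ⟨w, hwm,
    radical_span_insert_eq_of_forall_notMem D₁ h₁ hwm fun P hP => hw' P (Or.inl hP),
    radical_span_insert_eq_of_forall_notMem D₂ h₂ hwm fun P hP => hw' P (Or.inr hP)⟩

end Avoid

/-! ## §2 From finite sets to tuples, and the one-element move on finite sets -/

/-- A finite set of at most `d` elements is, up to the ideal it generates, the range of a `d`-tuple
(enumerate and repeat an element; the empty set is matched by the zero tuple). [folklore] -/
theorem exists_span_range_eq (D : Finset R) {d : ℕ} (hD : D.card ≤ d) :
    ∃ u : Fin d → R, Ideal.span (Set.range u) = Ideal.span (↑D : Set R) := by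
  classical
  by_cases hD0 : D = ∅
  · refine ⟨fun _ => 0, ?_⟩
    subst hD0
    rw [Finset.coe_empty, Ideal.span_empty, Ideal.span_eq_bot]
    rintro _ ⟨i, rfl⟩
    rfl
  obtain ⟨x₀, hx₀⟩ := Finset.nonempty_iff_ne_empty.mpr hD0
  set e := D.equivFin with he
  refine ⟨fun i => if h : (i : ℕ) < D.card then (e.symm ⟨i, h⟩ : R) else x₀, ?_⟩
  congr 1
  apply le_antisymm
  · rintro _ ⟨i, rfl⟩
    dsimp only
    split_ifs with h
    · exact (e.symm ⟨i, h⟩).2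
    · exact hx₀
  · intro x hx
    set j := e ⟨x, hx⟩ with hj
    refine ⟨⟨j, lt_of_lt_of_le j.2 hD⟩, ?_⟩
    dsimp only
    rw [dif_pos j.2, Fin.eta, hj, Equiv.symm_apply_apply]

/-- **The one-element move on finite generating sets**: in a Noetherian local ring of characteristic
`p` and dimension `d + 1`, Cohen–Macaulay in the sense of the route, if `(a, D)` and `(b, D)` are
parameter ideals with `|D| ≤ d` and `(a, D)` is Frobenius closed, then so is `(b, D)`
(`Move.isFrobeniusClosed_move` on a `d`-tuple enumerating `D`). [cite: FedderWatanabe1989, proof of Prop. 2.2] -/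
theorem isFrobeniusClosed_move_finset (p : ℕ) [Fact p.Prime] [IsNoetherianRing R] [IsLocalRing R]
    [CharP R p]
    (hCM : ∀ ⦃n : ℕ⦄ (s : Fin n → R), IsSystemOfParameters s → IsWeaklyRegular R (List.ofFn s))
    {d : ℕ} (hd : ringKrullDim R = ((d + 1 : ℕ) : WithBot ℕ∞)) (D : Finset R) (hD : D.card ≤ d)
    {a b : R} (ha : (Ideal.span (insert a (↑D : Set R))).radical = maximalIdeal R)
    (hb : (Ideal.span (insert b (↑D : Set R))).radical = maximalIdeal R)
    (hfc : IsFrobeniusClosed p (Ideal.span (insert a (↑D : Set R)))) :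
    IsFrobeniusClosed p (Ideal.span (insert b (↑D : Set R))) := by
  obtain ⟨u, hu⟩ := exists_span_range_eq D hD
  have key : ∀ x : R, Ideal.span (insert x (Set.range u)) = Ideal.span (insert x (↑D : Set R)) := by
    intro x
    rw [Ideal.span_insert, Ideal.span_insert, hu]
  rw [← key] at ha hb hfc ⊢
  exact Move.isFrobeniusClosed_move p hCM hd ha hb hfc

/-! ## §3 The chain of exchanges -/

/-- **Transfer along a chain of exchanges** (induction on the number `n` of generators allowed to
differ): for finite sets `A`, `B` (`|A|, |B| ≤ n`) and `C` (`|C| + n ≤ d + 1`) with `(A ∪ C)` and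
`(B ∪ C)` parameter ideals, Frobenius-closedness passes from `(A ∪ C)` to `(B ∪ C)`. Step: pick
`a ∈ A`, `b ∈ B` (non-empty by Krull's height theorem), a common parameter `w` for `(A ∖ a) ∪ C` and
`(B ∖ b) ∪ C` (`exists_mem_maximalIdeal_radical_eq_and`), move `a ↦ w`, recurse with `C ∪ {w}`, move
`w ↦ b`. [folklore] -/
theorem isFrobeniusClosed_transfer_aux (p : ℕ) [Fact p.Prime] [IsNoetherianRing R] [IsLocalRing R]
    [CharP R p]
    (hCM : ∀ ⦃n : ℕ⦄ (s : Fin n → R), IsSystemOfParameters s → IsWeaklyRegular R (List.ofFn s))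
    {d : ℕ} (hd : ringKrullDim R = ((d + 1 : ℕ) : WithBot ℕ∞)) :
    ∀ (n : ℕ) (A B C : Finset R), A.card ≤ n → B.card ≤ n → C.card + n ≤ d + 1 →
      (Ideal.span ((↑A ∪ ↑C : Set R))).radical = maximalIdeal R →
      (Ideal.span ((↑B ∪ ↑C : Set R))).radical = maximalIdeal R →
      IsFrobeniusClosed p (Ideal.span (↑A ∪ ↑C : Set R)) →
      IsFrobeniusClosed p (Ideal.span (↑B ∪ ↑C : Set R)) := by
  classical
  intro n
  induction n with
  | zero =>
    intro A B C hA hB _ _ _ hfc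
    have hA0 : A = ∅ := Finset.card_eq_zero.mp (Nat.le_zero.mp hA)
    have hB0 : B = ∅ := Finset.card_eq_zero.mp (Nat.le_zero.mp hB)
    subst hA0; subst hB0
    exact hfc
  | succ n ih =>
    intro A B C hA hB hC hradA hradB hfc
    -- `A` and `B` are non-empty: `C` alone has `≤ d` elements and cannot be `𝔪`-primary
    have hCd : C.card ≤ d := by omega
    have hne : ∀ E : Finset R, (Ideal.span ((↑E ∪ ↑C : Set R))).radical = maximalIdeal R →
        E.Nonempty := by
      intro E hE
      by_contra h0
      rw [Finset.not_nonempty_iff_eq_empty] at h0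
      subst h0
      rw [Finset.coe_empty, Set.empty_union] at hE
      have hmin : maximalIdeal R ∈ (Ideal.span (↑C : Set R)).minimalPrimes := by
        rw [← Ideal.radical_minimalPrimes, hE, Ideal.minimalPrimes_eq_subsingleton_self]
        exact Set.mem_singleton _
      exact ne_maximalIdeal_of_mem_minimalPrimes hd C hCd hmin rfl
    obtain ⟨a, ha⟩ := hne A hradA
    obtain ⟨b, hb⟩ := hne B hradB
    set A' := A.erase a with hA'
    set B' := B.erase b with hB'
    have hA'c : A'.card ≤ n := by
      rw [hA', Finset.card_erase_of_mem ha]; omega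
    have hB'c : B'.card ≤ n := by
      rw [hB', Finset.card_erase_of_mem hb]; omega
    -- the two `d`-element sub-ideals
    set D₁ : Finset R := A' ∪ C with hD₁
    set D₂ : Finset R := B' ∪ C with hD₂
    have hD₁c : D₁.card ≤ d := (Finset.card_union_le _ _).trans (by omega)
    have hD₂c : D₂.card ≤ d := (Finset.card_union_le _ _).trans (by omega)
    have hAset : (↑A ∪ ↑C : Set R) = insert a (↑D₁ : Set R) := by
      rw [hD₁, Finset.coe_union, ← Set.insert_union, hA', ← Finset.coe_insert,
        Finset.insert_erase ha]
    have hBset : (↑B ∪ ↑C : Set R) = insert b (↑D₂ : Set R) := by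
      rw [hD₂, Finset.coe_union, ← Set.insert_union, hB', ← Finset.coe_insert,
        Finset.insert_erase hb]
    rw [hAset] at hradA hfc
    rw [hBset] at hradB ⊢
    -- a common parameter `w`
    obtain ⟨w, hwm, hw₁, hw₂⟩ :=
      exists_mem_maximalIdeal_radical_eq_and hd D₁ D₂ hD₁c hD₂c hradA hradB
    -- move `a ↦ w`
    have h1 : IsFrobeniusClosed p (Ideal.span (insert w (↑D₁ : Set R))) :=
      isFrobeniusClosed_move_finset p hCM hd D₁ hD₁c hradA hw₁ hfc
    -- recurse with `C' = C ∪ {w}`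
    have hC'c : (insert w C).card + n ≤ d + 1 := (Nat.add_le_add_right (Finset.card_insert_le _ _) n).trans (by omega)
    have hset₁ : (↑A' ∪ ↑(insert w C) : Set R) = insert w (↑D₁ : Set R) := by
      rw [Finset.coe_insert, Set.union_insert, hD₁, Finset.coe_union]
    have hset₂ : (↑B' ∪ ↑(insert w C) : Set R) = insert w (↑D₂ : Set R) := by
      rw [Finset.coe_insert, Set.union_insert, hD₂, Finset.coe_union]
    have h2 : IsFrobeniusClosed p (Ideal.span (insert w (↑D₂ : Set R))) := by
      have h := ih A' B' (insert w C) hA'c hB'c hC'c (by rw [hset₁]; exact hw₁)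
        (by rw [hset₂]; exact hw₂) (by rw [hset₁]; exact h1)
      rwa [hset₂] at h
    -- move `w ↦ b`
    exact isFrobeniusClosed_move_finset p hCM hd D₂ hD₂c hw₂ hradB h2

/-- **One Frobenius closed parameter ideal ⇒ all** (Cohen–Macaulay local rings). Let `(R, 𝔪)` be a
Noetherian local ring of prime characteristic `p` in which every system of parameters is a weakly
regular sequence. If the ideal generated by ONE system of parameters `s` is Frobenius closed, then the
ideal generated by EVERY system of parameters `t` is Frobenius closed. (For Cohen–Macaulay rings this is
the ideal-theoretic form of Fedder's "F-injective ⇔ all parameter ideals Frobenius closed"; no local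
cohomology is used.) [cite: Fedder1983, Prop. 1.10 and Thm. 1.12; QuyShimomoto2017 §3] -/
theorem isFrobeniusClosed_of_isFrobeniusClosed_sop (p : ℕ) [Fact p.Prime] [IsNoetherianRing R]
    [IsLocalRing R] [CharP R p]
    (hCM : ∀ ⦃n : ℕ⦄ (s : Fin n → R), IsSystemOfParameters s → IsWeaklyRegular R (List.ofFn s))
    {n : ℕ} {s t : Fin n → R} (hs : IsSystemOfParameters s) (ht : IsSystemOfParameters t)
    (hfc : IsFrobeniusClosed p (Ideal.span (Set.range s))) :
    IsFrobeniusClosed p (Ideal.span (Set.range t)) := by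
  classical
  rcases n with _ | d
  · have h0 : Set.range t = Set.range s := by
      rw [Set.range_eq_empty, Set.range_eq_empty]
    rwa [h0]
  · have hd : ringKrullDim R = ((d + 1 : ℕ) : WithBot ℕ∞) := hs.1
    have hset : ∀ v : Fin (d + 1) → R,
        (↑(Finset.univ.image v) ∪ ↑(∅ : Finset R) : Set R) = Set.range v := by
      intro v
      rw [Finset.coe_image, Finset.coe_univ, Set.image_univ, Finset.coe_empty, Set.union_empty]
    have h := isFrobeniusClosed_transfer_aux p hCM hd (d + 1) (Finset.univ.image s)
      (Finset.univ.image t) ∅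
      (Finset.card_image_le.trans (by simp)) (Finset.card_image_le.trans (by simp)) (by simp)
      (by rw [hset]; exact hs.2) (by rw [hset]; exact ht.2) (by rw [hset]; exact hfc)
    rwa [hset] at h

/-! ## §4 Consequences for crux `FInjectiveMacaulayfication` -/

/-- **A Cohen–Macaulay local ring that is not F-injective has NO Frobenius closed parameter ideal**:
if every system of parameters is weakly regular and the ideal of SOME system of parameters `t` is not
Frobenius closed, then the ideal of EVERY system of parameters `s` fails to be Frobenius closed
(contrapositive of `isFrobeniusClosed_of_isFrobeniusClosed_sop`). [cite: Fedder1983, Thm. 1.12] -/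
theorem not_isFrobeniusClosed_of_sop (p : ℕ) [Fact p.Prime] [IsNoetherianRing R] [IsLocalRing R]
    [CharP R p]
    (hCM : ∀ ⦃n : ℕ⦄ (s : Fin n → R), IsSystemOfParameters s → IsWeaklyRegular R (List.ofFn s))
    {n : ℕ} {s t : Fin n → R} (hs : IsSystemOfParameters s) (ht : IsSystemOfParameters t)
    (hnt : ¬ IsFrobeniusClosed p (Ideal.span (Set.range t))) :
    ¬ IsFrobeniusClosed p (Ideal.span (Set.range s)) := fun hfc =>
  hnt (isFrobeniusClosed_of_isFrobeniusClosed_sop p hCM hs ht hfc)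

/-- **The crux's per-stalk clause from ONE good system of parameters.** For a Noetherian local domain
`R` of prime characteristic `p`: if every system of parameters (`d = dim R` elements generating an ideal
with maximal radical) is a weakly regular sequence, and ONE system of parameters generates an ideal that is
Frobenius closed in the inline sense of route `FrobeniusLadder`, then `R` satisfies the full per-stalk
clause of crux `FInjectiveMacaulayfication` (every parameter ideal Frobenius closed). So a candidate model
is certified point by point by exhibiting a single good system of parameters. [cite: Fedder1983, Thm. 1.12] -/
theorem fInjectiveClause_of_one_sop (p : ℕ) [Fact p.Prime] [IsDomain R]
    [IsNoetherianRing R] [IsLocalRing R] [CharP R p]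
    (hreg : ∀ d : ℕ, ringKrullDim R = d → ∀ s : Fin d → R,
      (Ideal.span (Set.range s)).radical.IsMaximal → IsWeaklyRegular R (List.ofFn s))
    (hone : ∃ (d : ℕ) (t : Fin d → R), ringKrullDim R = d ∧ (Ideal.span (Set.range t)).radical.IsMaximal ∧
      ∀ y : R, (∃ e : ℕ, y ^ p ^ e ∈ Ideal.span ((fun z : R => z ^ p ^ e) ''
        (Ideal.span (Set.range t) : Set R))) → y ∈ Ideal.span (Set.range t)) :
    IsDomain R ∧ ∀ d : ℕ, ringKrullDim R = d → ∀ s : Fin d → R,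
      (Ideal.span (Set.range s)).radical.IsMaximal →
        IsWeaklyRegular R (List.ofFn s) ∧
        ∀ y : R, (∃ e : ℕ, y ^ p ^ e ∈ Ideal.span ((fun z : R => z ^ p ^ e) ''
          (Ideal.span (Set.range s) : Set R))) → y ∈ Ideal.span (Set.range s) := by
  have hCM : ∀ ⦃n : ℕ⦄ (s : Fin n → R), IsSystemOfParameters s → IsWeaklyRegular R (List.ofFn s) :=
    fun n s hs => hreg n (isSystemOfParameters_iff.mp hs).1 s (isSystemOfParameters_iff.mp hs).2
  obtain ⟨d₀, t, hd₀, htrad, htfc⟩ := hone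
  have ht : IsSystemOfParameters t := isSystemOfParameters_iff.mpr ⟨hd₀, htrad⟩
  have htfc' : IsFrobeniusClosed p (Ideal.span (Set.range t)) := (isFrobeniusClosed_iff p).mpr htfc
  refine ⟨inferInstance, fun d hd s hsrad => ⟨hreg d hd s hsrad, ?_⟩⟩
  have hdd : d = d₀ := by
    have h := hd.symm.trans hd₀
    exact_mod_cast h
  subst hdd
  have hs : IsSystemOfParameters s := isSystemOfParameters_iff.mpr ⟨hd, hsrad⟩
  exact (isFrobeniusClosed_iff p).mp (isFrobeniusClosed_of_isFrobeniusClosed_sop p hCM ht hs htfc')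

/-- **COMPLETE NO-GO FOR PARAMETER-IDEAL CENTRES.** Let `R` be a Noetherian local domain of prime
characteristic `p` and dimension `d + 1` which is Cohen–Macaulay (every system of parameters weakly
regular) but NOT F-injective in the sense of the crux: the ideal of some system of parameters `t` is not
Frobenius closed. Then for EVERY system of parameters `g` of `R`, the `g_d`-chart
`R[gᵢ/g_d] ⊆ Frac R` of the blow-up of `Spec R` along `(g)` has a closed point whose local ring
violates the per-stalk clause of crux `FInjectiveMacaulayfication` — no blow-up of an ideal generated by a
system of parameters is the model the crux asks for over such a point (`not_isFrobeniusClosed_of_sop` +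
`parameterCentre_noGo`). This is the general form, for every prime `p` and every such ring, of the route
header's "why it might fail" for the transplanted Kawasaki engine and of the toy witnesses p129192 /
p129572 (`E₈⁰`). [folklore] -/
theorem parameterCentre_noGo_of_not_fInjective (p : ℕ) [Fact p.Prime] {S : Type} [CommRing S]
    [IsDomain S] [IsNoetherianRing S] [IsLocalRing S] [CharP S p]
    (hCM : ∀ ⦃n : ℕ⦄ (s : Fin n → S), IsSystemOfParameters s → IsWeaklyRegular S (List.ofFn s))
    {d : ℕ} {t : Fin (d + 1) → S} (ht : IsSystemOfParameters t)
    (hnt : ¬ IsFrobeniusClosed p (Ideal.span (Set.range t)))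
    (g : Fin (d + 1) → S) (hg : IsSystemOfParameters g) :
    ∃ (M : Ideal (Algebra.adjoin S (Set.range fun i : Fin (d + 1) =>
        algebraMap S (FractionRing S) (g i) / algebraMap S (FractionRing S) (g (Fin.last d)))))
      (_ : M.IsMaximal),
      ¬ (IsDomain (Localization.AtPrime M) ∧
          ∀ n : ℕ, ringKrullDim (Localization.AtPrime M) = n →
            ∀ s : Fin n → Localization.AtPrime M, (Ideal.span (Set.range s)).radical.IsMaximal →
              RingTheory.Sequence.IsWeaklyRegular (Localization.AtPrime M) (List.ofFn s) ∧
              ∀ w : Localization.AtPrime M, (∃ e : ℕ, w ^ p ^ e ∈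
                Ideal.span ((fun z : Localization.AtPrime M => z ^ p ^ e) ''
                  (Ideal.span (Set.range s) : Set (Localization.AtPrime M)))) →
                w ∈ Ideal.span (Set.range s)) := by
  have hng : ¬ IsFrobeniusClosed p (Ideal.span (Set.range g)) :=
    not_isFrobeniusClosed_of_sop p hCM hg ht hnt
  have hnot : ∃ y : S, (∃ e : ℕ, y ^ p ^ e ∈ Ideal.span ((fun z : S => z ^ p ^ e) ''
      (Ideal.span (Set.range g) : Set S))) ∧ y ∉ Ideal.span (Set.range g) := by
    by_contra h
    push Not at h
    exact hng ((isFrobeniusClosed_iff p).mpr fun y hy => h y hy)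
  exact parameterCentre_noGo p S d g (hCM g hg) hnot

/-- **One Frobenius closed parameter ideal ⇒ all** — `isFrobeniusClosed_of_isFrobeniusClosed_sop` with
every binder explicit (universe `0`). [cite: Fedder1983, Thm. 1.12] -/
theorem frobeniusClosed_one_sop_all : ∀ (p : ℕ) [Fact p.Prime] (R : Type) [CommRing R] [IsNoetherianRing R] [IsLocalRing R] [CharP R p], (∀ ⦃n : ℕ⦄ (s : Fin n → R), Literature.RingTheory.TightClosure.IsSystemOfParameters s → RingTheory.Sequence.IsWeaklyRegular R (List.ofFn s)) → ∀ (n : ℕ) (s t : Fin n → R), Literature.RingTheory.TightClosure.IsSystemOfParameters s → Literature.RingTheory.TightClosure.IsSystemOfParameters t → Literature.RingTheory.TightClosure.IsFrobeniusClosed p (Ideal.span (Set.range s)) → Literature.RingTheory.TightClosure.IsFrobeniusClosed p (Ideal.span (Set.range t)) :=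
  fun p _ _ _ _ _ _ hCM _ _ _ hs ht hfc => isFrobeniusClosed_of_isFrobeniusClosed_sop p hCM hs ht hfc

end Summit.ResolutionOfSingularities.ResolutionOfSingularities.Theorems.FInjectiveMacaulayfication.OneSop
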